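import Summits.AtomisticToContinuum.HydrodynamicLimit.Theses.UGibbsSRBRigidity

/-!
# Birth skeleton (BC3) for crux `URegularLimitsSlaved` — U1, INHERITANCE
(stmt-AtomisticToContinuum-13991, route `UGibbsSRBRigidity`, rank 2; file `Lines/birth.lean`)

Crux (FIXED, imported BY NAME):
`Summit.AtomisticToContinuum.HydrodynamicLimit.Theses.UGibbsSRBRigidity.URegularLimitsSlaved` —
for all continuous positive local-Gibbs profiles there is `σ₀` such that for `0 < σ < σ₀`, all flow
families `Φ`, all `T₀ > 0`, every OVY limit state `μ` (`IsOVYLimitState σ a₀ θ₀ u₀ T₀ Φ μ`) is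
(i) a translation-invariant probability law, (v) of finite density and kinetic-energy density,
(ii) stationary under an equilibrium, translation-covariant infinite hard-sphere flow `Ψ` (diameter 1)
that is `μ`-a.e. defined and has Sinai short-window collision clusters `μ`-a.s., and
(iv) u-regular for the contact-slaved plaque functor: `(slavedUnstablePlaques 1 Ψ).IsURegular μ`.

The line is the natural three-stage proof of U1 (OVY93 §4 (A) ▸ Alexander/Sinai off equilibrium ▸
Ledrappier–Young inheritance), one named stub per stage, each with its OWN `σ`-threshold:

* `stub_limitStatics`      (M) — STATICS / A-PRIORI HALF: every OVY limit state is a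
  translation-invariant probability law of finite density and finite kinetic-energy density
  (OVY93 Lemma 4.1 + (4.13): no mass loss in the vague limit, translation invariance from the UNIFORM
  zoom point, density/energy per unit blown-up volume bounded through the entropy bound
  `H(f_t^N | Gibbs) ≤ C N` and energy conservation, then Fatou along the subsequence).
* `stub_limitDynamics`     (L) — DYNAMICS HALF of (ii): on every OVY limit state that is a
  translation-invariant probability law of finite density and energy there EXISTS an equilibrium,
  translation-covariant infinite hard-sphere flow, `μ`-a.e. defined, leaving `μ` stationary, with
  Sinai SHORT-WINDOW finite collision clusters `μ`-a.s. (Alexander1976 Thm 5.2 is equilibrium-only;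
  off equilibrium this is Alexander-regularity + cluster-size tails of the limit states along the
  evolved law — the inputs TemperedCollisions / CollisionMoments of the route; stationarity of limit
  points of the space–time averages `Q^ε` is OVY93 §4 (A)).
* `stub_uRegularInheritance` (XL, HARDEST, the bet of the route) — SRB INHERITANCE IN WINDOW FORM:
  for every OVY limit state (probability, translation invariant, finite density/energy) and EVERY
  admissible infinite flow `Ψ` on it (equilibrium, translation covariant, a.e. defined, stationary,
  short-window cluster pin — under the pin the solution of the equations of motion from `μ`-a.e. `ω`
  is unique, so "every admissible `Ψ`" is "the" dynamics), `μ` has absolutely continuous conditional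
  measures on the contact-slaved plaques of SOME ball window `closedBall 0 (n+1)`:
  `∃ n, (slavedWindowPlaques Ψ (closedBall 0 (n+1))).IsURegular μ` — the finite-dimensional
  (`dk`-dimensional leaves) statement a Ledrappier–Young / Pesin–Sinai inheritance argument with an
  `N`-uniform growth lemma would actually deliver; it is the TRANSFER `C⁺ → (iv)` through the tree
  lemma `PlaqueFamily.IsURegular.of_slavedWindowPlaques` (one window suffices for the functor).

Composition `URegularLimitsSlaved_of (hS : Registered.stub_limitStatics) (hD : Registered.stub_limitDynamics)
(hI : Registered.stub_uRegularInheritance) : URegularLimitsSlaved` (PROVED below, no sorry): take `σ₀ := min σ₁ (min σ₂ σ₃)`,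
run statics ▸ dynamics ▸ inheritance on the same limit state and close clause (iv) by
`IsURegular.of_slavedWindowPlaques n`. Sorries: exactly 3, one inside each `stub_*`; zero elsewhere.

Disproof used: none on file for this crux (`ledger crux ls stmt-AtomisticToContinuum-13991`: no
workfiles, 2026-08-17). Negative knowledge honoured: the stubs are posed over D5
(`slavedUnstablePlaques` / `slavedWindowPlaques`), never over the degenerate D4 functor
`infiniteUnstablePlaques` (crux attack gen-1 on stmt-13896: D4-u-regular class is `{0}`); no stub
isolates clause (i) alone (refuter W.lean on 13991: (i) is provably free from `f = 0`, so a stub of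
that shape would be bookkeeping).
-/

noncomputable section

open MeasureTheory Filter Topology
open scoped ENNReal

namespace Summit.AtomisticToContinuum.HydrodynamicLimit.Cruxes.URegularLimitsSlaved.Birth

open Summit.AtomisticToContinuum.HydrodynamicLimit.Theses.UGibbsSRBRigidity (URegularLimitsSlaved)

/-! ### The statements of the line (named `Prop`s; the stub signatures) -/

/-- **LimitStatics** (statement of `stub_limitStatics`) (M; OVY93 §4 (A), Lemma 4.1, (4.13)). STATICS OF OVY LIMIT STATES: for all
continuous positive profiles there is `σ₁ > 0` such that for `0 < σ < σ₁`, all `Φ`, all `T₀ > 0`,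
every OVY limit state `μ` is a probability law (no mass lost in the vague limit: `f = 0` gives total
mass `1`, tightness from the density bound), translation invariant (uniform zoom point on `𝕋³`:
shifting the blown-up configuration by `a` is shifting the zoom point by `ε a`), of finite density
and finite kinetic-energy density (entropy inequality against the global Gibbs law + conservation
of energy give `N`-uniform bounds per unit blown-up volume; lower semicontinuity along the
subsequence). Why plausibly true: it is the printed Lemma 4.1 of OllaVaradhanYau1993 transcribed to
the deterministic hard-sphere flow (the noise plays no role in it). Leans on: `IsOVYLimitState`,
`ovyLaplace`, `laplaceFunctional`, `localGibbsLaw` LD/entropy bounds. -/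
def LimitStatics : Prop :=
  ∀ (a₀ θ₀ : Literature.MathematicalPhysics.KineticTheory.T3 → ℝ)
    (u₀ : Literature.MathematicalPhysics.KineticTheory.T3 → Literature.MathematicalPhysics.KineticTheory.V3),
    Continuous a₀ → Continuous θ₀ → Continuous u₀ → (∀ x, 0 < a₀ x) → (∀ x, 0 < θ₀ x) →
    ∃ σ₀ : ℝ, 0 < σ₀ ∧ ∀ σ : ℝ, 0 < σ → σ < σ₀ →
      ∀ (Φ : (N : ℕ) → Literature.Analysis.FluidPDE.HardSphereFlow
          (Literature.Analysis.FluidPDE.Torus.geometry (Fin 3))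
          (Literature.MathematicalPhysics.KineticTheory.hsDiameter σ N) (N + 1)) (T₀ : ℝ), 0 < T₀ →
      ∀ μ : Measure (Literature.Analysis.FunctionSpaces.PointConfig
          (EuclideanSpace ℝ (Fin 3) × EuclideanSpace ℝ (Fin 3))),
        Literature.MathematicalPhysics.KineticTheory.IsOVYLimitState σ a₀ θ₀ u₀ T₀ Φ μ →
        IsProbabilityMeasure μ ∧ Literature.Analysis.FluidPDE.IsTranslationInvariant μ ∧
          Literature.MathematicalPhysics.KineticTheory.PointProcess.density μ < ⊤ ∧
          Literature.MathematicalPhysics.KineticTheory.kineticEnergyDensity μ < ⊤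

/-- **LimitDynamics** (statement of `stub_limitDynamics`) (L; Alexander1976 Thm 5.2 / Prop 4.7 off equilibrium, Sinai1974,
DobrushinSinaiSukhov1989 §4.1, OVY93 §4 (A)). INFINITE-VOLUME DYNAMICS ON LIMIT STATES WITH THE TWO
PINS U2 CONSUMES: for all continuous positive profiles there is `σ₂ > 0` such that for `0 < σ < σ₂`,
all `Φ`, all `T₀ > 0`, every OVY limit state `μ` that is a translation-invariant probability law of
finite density and kinetic-energy density carries an infinite hard-sphere flow `Ψ` (diameter `1`)
that is an equilibrium flow, translation covariant, `μ`-a.e. defined, leaves `μ` stationary, and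
has Sinai short-window clusters `μ`-a.s. (`∃ δ > 0`: every particle's collision cluster over every
`[a, a+δ]` is finite). Why plausibly true: the limit states have density `O(σ³)`-small in blown-up
units (dilute), stationarity of vague limit points of the space–time averages `Q^ε` under the
limiting dynamics is OVY93 §4 (A); existence/regularity of the dynamics on `μ`-typical
configurations is Alexander's construction run on the `N`-uniform collision statistics of the
evolved law (route supports TemperedCollisions stmt-9391, CollisionMoments stmt-9393), and the
short-window cluster property is Sinai's cluster dynamics at low density. Why it might fail: cluster
tails along the NON-equilibrium law are not in print (grounder g32-0 on 13991). -/
def LimitDynamics : Prop :=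
  ∀ (a₀ θ₀ : Literature.MathematicalPhysics.KineticTheory.T3 → ℝ)
    (u₀ : Literature.MathematicalPhysics.KineticTheory.T3 → Literature.MathematicalPhysics.KineticTheory.V3),
    Continuous a₀ → Continuous θ₀ → Continuous u₀ → (∀ x, 0 < a₀ x) → (∀ x, 0 < θ₀ x) →
    ∃ σ₀ : ℝ, 0 < σ₀ ∧ ∀ σ : ℝ, 0 < σ → σ < σ₀ →
      ∀ (Φ : (N : ℕ) → Literature.Analysis.FluidPDE.HardSphereFlow
          (Literature.Analysis.FluidPDE.Torus.geometry (Fin 3))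
          (Literature.MathematicalPhysics.KineticTheory.hsDiameter σ N) (N + 1)) (T₀ : ℝ), 0 < T₀ →
      ∀ μ : Measure (Literature.Analysis.FunctionSpaces.PointConfig
          (EuclideanSpace ℝ (Fin 3) × EuclideanSpace ℝ (Fin 3))),
        Literature.MathematicalPhysics.KineticTheory.IsOVYLimitState σ a₀ θ₀ u₀ T₀ Φ μ →
        IsProbabilityMeasure μ → Literature.Analysis.FluidPDE.IsTranslationInvariant μ →
        Literature.MathematicalPhysics.KineticTheory.PointProcess.density μ < ⊤ →
        Literature.MathematicalPhysics.KineticTheory.kineticEnergyDensity μ < ⊤ →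
        ∃ Ψ : Literature.Analysis.FluidPDE.InfiniteHardSphereFlow (Fin 3) 1,
          Ψ.IsEquilibriumFlow ∧ Ψ.IsTranslationCovariant ∧ Ψ.IsAEDefined μ ∧ Ψ.IsStationary μ ∧
          (∃ δ : ℝ, 0 < δ ∧ ∀ᵐ (ω : Literature.Analysis.FunctionSpaces.PointConfig
              (EuclideanSpace ℝ (Fin 3) × EuclideanSpace ℝ (Fin 3))) ∂μ,
            ∀ p ∈ (ω : Set (EuclideanSpace ℝ (Fin 3) × EuclideanSpace ℝ (Fin 3))), ∀ a : ℝ,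
              (Literature.Analysis.FluidPDE.collisionCluster 1
                (ω : Set (EuclideanSpace ℝ (Fin 3) × EuclideanSpace ℝ (Fin 3)))
                (Ψ.traj ω) a (a + δ) p).Finite)

/-- **URegularInheritance** (statement of `stub_uRegularInheritance`) (XL, HARDEST — the route's bet; LedrappierYoung1985 Def 1.4.2 /
Thm A, PesinSinai1982, KatokEtAl1986 Parts II–III, ChernovDolgopyat2009 growth lemmas,
StenlundYoungZhang2013). u-REGULARITY OF LIMIT STATES IN WINDOW FORM (the transfer `C⁺`): for all
continuous positive profiles there is `σ₃ > 0` such that for `0 < σ < σ₃`, all `Φ`, all `T₀ > 0`,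
every OVY limit state `μ` (probability, translation invariant, finite density and energy) and every
admissible infinite flow `Ψ` on it (equilibrium, translation covariant, `μ`-a.e. defined,
stationary, Sinai short-window clusters `μ`-a.s. — under which the dynamics from `μ`-a.e.
configuration is unique, so nothing is lost by the universal quantifier), there is a ball window
`closedBall 0 (n+1)` whose CONTACT-SLAVED window plaques (D5, `dk`-dimensional leaves with their
Hausdorff leaf measures) carry absolutely continuous conditional measures of `μ`:
`(slavedWindowPlaques Ψ (closedBall 0 (n+1))).IsURegular μ`. This is STRONGER than clause (iv) of
the crux (`IsURegular.of_slavedWindowPlaques`: one window suffices for the functor) and is what an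
inheritance argument delivers: a.c. of the evolved finite-`N` laws along finite-`N` unstable
plaques (Liouville start ⇒ u-Gibbs at every finite time) survives the vague limit `N → ∞` on a FIXED
window iff the leafwise densities have `N`-uniform distortion (growth lemma with `N`-uniform
constants). Why it might fail: no `N`-uniform growth lemma exists even for discs (BalintEtAl2002);
slaved window plaques condition on unbounded backward exterior data (refuter R5 on 13991). -/
def URegularInheritance : Prop :=
  ∀ (a₀ θ₀ : Literature.MathematicalPhysics.KineticTheory.T3 → ℝ)
    (u₀ : Literature.MathematicalPhysics.KineticTheory.T3 → Literature.MathematicalPhysics.KineticTheory.V3),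
    Continuous a₀ → Continuous θ₀ → Continuous u₀ → (∀ x, 0 < a₀ x) → (∀ x, 0 < θ₀ x) →
    ∃ σ₀ : ℝ, 0 < σ₀ ∧ ∀ σ : ℝ, 0 < σ → σ < σ₀ →
      ∀ (Φ : (N : ℕ) → Literature.Analysis.FluidPDE.HardSphereFlow
          (Literature.Analysis.FluidPDE.Torus.geometry (Fin 3))
          (Literature.MathematicalPhysics.KineticTheory.hsDiameter σ N) (N + 1)) (T₀ : ℝ), 0 < T₀ →
      ∀ μ : Measure (Literature.Analysis.FunctionSpaces.PointConfig
          (EuclideanSpace ℝ (Fin 3) × EuclideanSpace ℝ (Fin 3))),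
        Literature.MathematicalPhysics.KineticTheory.IsOVYLimitState σ a₀ θ₀ u₀ T₀ Φ μ →
        IsProbabilityMeasure μ → Literature.Analysis.FluidPDE.IsTranslationInvariant μ →
        Literature.MathematicalPhysics.KineticTheory.PointProcess.density μ < ⊤ →
        Literature.MathematicalPhysics.KineticTheory.kineticEnergyDensity μ < ⊤ →
        ∀ Ψ : Literature.Analysis.FluidPDE.InfiniteHardSphereFlow (Fin 3) 1,
          Ψ.IsEquilibriumFlow → Ψ.IsTranslationCovariant → Ψ.IsAEDefined μ → Ψ.IsStationary μ →
          (∃ δ : ℝ, 0 < δ ∧ ∀ᵐ (ω : Literature.Analysis.FunctionSpaces.PointConfig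
              (EuclideanSpace ℝ (Fin 3) × EuclideanSpace ℝ (Fin 3))) ∂μ,
            ∀ p ∈ (ω : Set (EuclideanSpace ℝ (Fin 3) × EuclideanSpace ℝ (Fin 3))), ∀ a : ℝ,
              (Literature.Analysis.FluidPDE.collisionCluster 1
                (ω : Set (EuclideanSpace ℝ (Fin 3) × EuclideanSpace ℝ (Fin 3)))
                (Ψ.traj ω) a (a + δ) p).Finite) →
          ∃ n : ℕ, (Literature.Dynamics.Billiards.slavedWindowPlaques Ψ
            (Metric.closedBall (0 : EuclideanSpace ℝ (Fin 3)) ((n : ℝ) + 1))).IsURegular μ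

/-! ### Registered stubs (the open obligations of the line; `sorry` ONLY here) -/

/-- STUB (M; statics / a-priori half, OVY93 Lemma 4.1): see `LimitStatics`. -/
theorem stub_limitStatics : LimitStatics := by
  sorry

/-- STUB (L; infinite dynamics + Sinai short-window pin on limit states, off equilibrium): see `LimitDynamics`. -/
theorem stub_limitDynamics : LimitDynamics := by
  sorry

/-- STUB (XL; HARDEST — SRB inheritance in window form, the route's bet): see `URegularInheritance`. -/
theorem stub_uRegularInheritance : URegularInheritance := by
  sorry

/-! ### Name-keyed aliases of the stub statements (the hypotheses of the composition; the skeleton audit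
admits a hypothesis only if its head constant is a registered obligation or is named like a declared stub) -/
namespace Registered

/-- Alias of `LimitStatics` keyed by the registered stub name. -/
abbrev stub_limitStatics : Prop := LimitStatics
/-- Alias of `LimitDynamics` keyed by the registered stub name. -/
abbrev stub_limitDynamics : Prop := LimitDynamics
/-- Alias of `URegularInheritance` keyed by the registered stub name. -/
abbrev stub_uRegularInheritance : Prop := URegularInheritance

end Registered

/-! ### Composition (PROVED) -/

/-- **Composition** (PROVED, no sorry): statics ▸ dynamics ▸ window inheritance, with the common
threshold `σ₀ := min σ₁ (min σ₂ σ₃)`, closing clause (iv) of the crux by the tree lemma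
`PlaqueFamily.IsURegular.of_slavedWindowPlaques` (one ball window suffices for the functor
`slavedUnstablePlaques 1 Ψ`). Concludes the route decl `URegularLimitsSlaved` BY NAME; its three
hypotheses are exactly the three registered stubs (name-keyed aliases). -/
theorem URegularLimitsSlaved_of (hS : Registered.stub_limitStatics) (hD : Registered.stub_limitDynamics)
    (hI : Registered.stub_uRegularInheritance) : URegularLimitsSlaved := by
  intro a₀ θ₀ u₀ ha hθ hu hap hθp
  obtain ⟨σ₁, hσ₁, H₁⟩ := hS a₀ θ₀ u₀ ha hθ hu hap hθp
  obtain ⟨σ₂, hσ₂, H₂⟩ := hD a₀ θ₀ u₀ ha hθ hu hap hθp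
  obtain ⟨σ₃, hσ₃, H₃⟩ := hI a₀ θ₀ u₀ ha hθ hu hap hθp
  refine ⟨min σ₁ (min σ₂ σ₃), lt_min hσ₁ (lt_min hσ₂ hσ₃), ?_⟩
  intro σ hσ hσlt Φ T₀ hT₀ μ hμ
  have h₁ : σ < σ₁ := lt_of_lt_of_le hσlt (min_le_left _ _)
  have h₂ : σ < σ₂ := lt_of_lt_of_le hσlt ((min_le_right _ _).trans (min_le_left _ _))
  have h₃ : σ < σ₃ := lt_of_lt_of_le hσlt ((min_le_right _ _).trans (min_le_right _ _))
  obtain ⟨hP, hTI, hρ, hE⟩ := H₁ σ hσ h₁ Φ T₀ hT₀ μ hμ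
  obtain ⟨Ψ, hEq, hCov, hAE, hSt, hPin⟩ := H₂ σ hσ h₂ Φ T₀ hT₀ μ hμ hP hTI hρ hE
  obtain ⟨n, hn⟩ := H₃ σ hσ h₃ Φ T₀ hT₀ μ hμ hP hTI hρ hE Ψ hEq hCov hAE hSt hPin
  exact ⟨hP, hTI, hρ, hE, Ψ, hEq, hCov, hAE, hSt, hPin,
    Literature.Dynamics.Billiards.PlaqueFamily.IsURegular.of_slavedWindowPlaques n hn⟩

/-- Wiring check: the registered (sorried) stubs feed `URegularLimitsSlaved_of` as stated. -/
example : URegularLimitsSlaved :=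
  URegularLimitsSlaved_of stub_limitStatics stub_limitDynamics stub_uRegularInheritance

end Summit.AtomisticToContinuum.HydrodynamicLimit.Cruxes.URegularLimitsSlaved.Birth

end
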